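import Summits.ABC.StewartYu.PadicG3TwoLevelZeroAll
import Summits.ABC.StewartYu.PadicG3TwoMainChainSat
import HarnessLib

/-!
# Cell abc-stewartyu, WP-L.P(2) (crux r4 `PadicCoreTwoRat`, stmt-ABC-20504), layer K2b (Option S′): the ALL-NODES
# inner chain of level `0` on the 𝔑-THREADED family, and the level induction `mainTwoA` with both chains discharged

`Summits/ABC/StewartYu/PadicG3TwoLevelZeroAllSat.lean` — cell `abc-stewartyu` (HOME `run/shared/lean/pub/abc-stewartyu/`),
route `YuMatveevShapeRat`, seat p3 (g9, WP-L.P(2) lead); twin of p5's `PadicG3TwoLevelZeroAll` (Option S′ of the closed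
crux `Y07Two`: at level `0` Siegel delivers vanishing at EVERY `|x| ≤ X`, so sub-step `0` of level `0` runs from all
nodes) on the 𝔑-threaded family of `PadicG3TwoMainChainSat` (shape slot `ShSat F Bv Sh`, virtual clearing denominator
`F.Dm (Bv I) x`).  One `Prop`-structure and theorems; no named fact.

* `KFinalTwoAllSat σ F Bv I` — `KFinalTwoAll` with the Liouville constant `KTwoSat`;
* **`kchainTwoAll_of_kfinalAllSat`** — `KFinalTwoAllSat σ F Bv I → KChainTwoAll σ (ShSat F Bv Sh) I` (every sub-step
  by `SatData.kstep_Icc_sat`);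
* **`mainTwoA_of_kfinalSat`** — the landed `mainTwoA` (verbatim) with `KFinalTwoAllSat` at level `0` and `KFinalTwoSat`
  at `1 ≤ I ≤ I*`: the last-level admissible family with its vanishing, given `SiegelTwo` and the third steps.

WHAT THIS IS NOT: no schedule, no numbers, no third step, no END; no crux moves (A1.L not moved).

References: K. Yu, Acta Math. 211 (2013), Lemma 5.2 and (5.22); Yu. V. Nesterenko, LNM 1819 (2003), §4.1 (4.3)–(4.5).
-/

noncomputable section

open Finset Polynomial
open scoped Matrix
open Literature.NumberTheory.Transcendental
open Literature.NumberTheory.Transcendental.CW77.Setup (Tau tauNorm)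
open Literature.NumberTheory.Transcendental.PadicCW77 (condExp)

namespace Summit.ABC.StewartYu

namespace TwoSetup

variable {S : TwoSetup} {ι : Type*} (σ : S.G3TwoSched) (F : S.SatData) (Bv : ℕ → Fin (S.d + 1) → ℕ)
  (Sh : ℕ → S.G3Fam ι → Prop)

/-- **THE RECORD'S OBLIGATIONS FOR AN ALL-NODES INNER CHAIN OF LEVEL `I` ON THE 𝔑-THREADED FAMILY** (= `KFinalTwoAll`
with the Liouville constant `KTwoSat`). [cite: Yu2013, Lemma 5.2 (5.28)–(5.31); shape only] -/
structure KFinalTwoAllSat (I : ℕ) : Prop where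
  /-- the chain starts at the level's initial range -/
  Nsub_zero : σ.Nsub I 0 = σ.N0 I
  /-- the chain reaches the level's final range -/
  Nfin_le : σ.Nfin I ≤ σ.Nsub I (σ.kst I)
  /-- the chain's order budget -/
  Tfin_le : σ.Tfin I + σ.kst I * σ.tdec I ≤ σ.T0 I
  /-- at least one sub-step -/
  one_le_kst : 1 ≤ σ.kst I
  /-- positive order decrement -/
  one_le_tdec : 1 ≤ σ.tdec I
  /-- the directional bound is a nonnegative number -/
  Xb_nonneg : 0 ≤ σ.Xb I
  /-- the `Y₀`-weight denominators are positive -/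
  one_le_den₀ : ∀ (x : ℤ) (τ : Tau S.d), 1 ≤ σ.den₀ I x τ
  /-- the Liouville constant is positive -/
  KTwoSat_pos : ∀ (x : ℤ) (τ : Tau S.d), 0 < KTwoSat σ F Bv I x τ
  /-- the numeric inequality of every sub-step (all nodes) -/
  hfinal : ∀ k, k < σ.kst I → ∀ x₁ : ℤ, |x₁| ≤ (σ.Nsub I (k + 1) : ℤ) → ∀ τ : Tau S.d,
    tauNorm τ + σ.tdec I ≤ σ.T0 I - k * σ.tdec I →
    max (σ.Bw I * ‖S.Λ₀‖ * (2 : ℝ) ^ σ.tdec I * (2 : ℝ) ^ condExp 2 (2 * σ.Nsub I k + 1) (σ.tdec I))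
        (σ.Bw I / (4 * (2 : ℝ) ^ σ.m) ^ gainExpA σ I k) < 1 / KTwoSat σ F Bv I x₁ τ

/-- **THE ALL-NODES INNER CHAIN ON THE 𝔑-THREADED FAMILY FROM THE RECORD'S NUMERICS**:
`KFinalTwoAllSat σ F Bv I → KChainTwoAll σ (ShSat F Bv Sh) I` (every sub-step by `SatData.kstep_Icc_sat`).
[cite: Yu2013, Lemma 5.2] [cite: Nesterenko2003, §4.1 (4.3)–(4.5)] -/
theorem kchainTwoAll_of_kfinalAllSat {I : ℕ} (hfin : KFinalTwoAllSat σ F Bv I) :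
    KChainTwoAll σ (ShSat F Bv Sh) I := by
  intro Λ hadm hvan
  obtain ⟨hBw0, hP0, hM0, hK⟩ := kstep_data_of_admSat σ F Bv Sh hadm hfin.Xb_nonneg
  have hvbox := vbox_of_adm σ F Bv Sh hadm
  have ht : 1 ≤ σ.tdec I := hfin.one_le_tdec
  have hR : ∀ (x : ℤ) (τ : Tau S.d), ∀ i ∈ Λ.B, ∃ z₀ : ℤ,
      (σ.den₀ I x τ : ℚ) * (hasseDeriv τ.1 (Λ.R i)).eval (x : ℚ) = z₀ ∧ |z₀| ≤ σ.M₀ I x τ :=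
    fun x τ i hi => hadm.hasse i hi x τ
  have hchain : ∀ k, k ≤ σ.kst I → Λ.vanish nodesAll (σ.Nsub I k) (σ.T0 I - k * σ.tdec I) := by
    intro k
    induction k with
    | zero =>
      intro _
      rw [hfin.Nsub_zero, Nat.zero_mul, Nat.sub_zero]
      exact hvan
    | succ k ih =>
      intro hk
      have hprev := ih (by omega)
      have hzero : ∀ x : ℤ, |x| ≤ (σ.Nsub I k : ℤ) → ∀ τ'' : Tau S.d,
          tauNorm τ'' < σ.T0 I - k * σ.tdec I → S.g3φ Λ.R Λ.u Λ.uθ Λ.B Λ.p τ'' x = 0 :=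
        fun x hx τ'' hτ'' => hprev x hx trivial τ'' hτ''
      have hfinalk := hfin.hfinal k (by omega)
      have key := F.kstep_Icc_sat Λ.R Λ.u Λ.uθ Λ.B Λ.p Λ.i₀ hadm.slab (N := σ.Nsub I k)
        (N' := σ.Nsub I (k + 1)) (Tlo := σ.T0 I - k * σ.tdec I) ht hBw0 hadm.wt hzero hvbox
        (σ.den₀ I) hfin.one_le_den₀ (σ.M₀ I) hR hadm.dir_le hadm.p_le (KTwoSat σ F Bv I)
        hfin.KTwoSat_pos hK hfinalk
      intro x hx _ τ hτ
      refine key x hx τ ?_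
      rw [Nat.succ_mul] at hτ
      omega
  have hlast := hchain (σ.kst I) le_rfl
  refine Λ.vanish_mono hfin.Nfin_le ?_ hlast
  have := hfin.Tfin_le
  omega

/-- **THE LEVEL INDUCTION ON THE 𝔑-THREADED FAMILY with both chains discharged from the record's numerics**
(Option S′): `SiegelTwo` + `KFinalTwoAllSat` at level `0` + `KFinalTwoSat` at `1 ≤ I ≤ I*` + the third steps ⇒ the
last-level admissible family with its vanishing at all `|x| ≤ Nfin I*`, `|τ| < Tfin I*`.
[cite: Yu2013, §5 (5.19)–(5.22); shape only] -/
theorem mainTwoA_of_kfinalSat (hS : SiegelTwo σ (ShSat F Bv Sh)) (hfin0 : KFinalTwoAllSat σ F Bv 0)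
    (hfin : ∀ I, 1 ≤ I → I ≤ σ.Istar → KFinalTwoSat σ F Bv I)
    (hth : ∀ I, I < σ.Istar → ThirdStepTwo σ (ShSat F Bv Sh) I) :
    ∃ Λ : S.G3Fam ι, S.G3Adm σ (ShSat F Bv Sh) σ.Istar Λ ∧
      Λ.vanish nodesAll (σ.Nfin σ.Istar) (σ.Tfin σ.Istar) :=
  mainTwoA σ (ShSat F Bv Sh) hS (kchainTwoAll_of_kfinalAllSat σ F Bv Sh hfin0)
    (fun I h1 hI => kchainTwo_of_kfinalSat σ F Bv Sh (hfin I h1 hI)) hth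

end TwoSetup

end Summit.ABC.StewartYu

end
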